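import Summits.QuantumFields.YangMills.Theorems.UnitScaleTiltProp7LandauTransversalityMargin
import HarnessLib

/-!
# Route `UnitScaleTilt`, crux K1 child «MinimiserStabilityRegPr» (stmt-QuantumFields-19200), skeleton v10, stub `stub_existenceMinimalOrbit` (EX), route (α) —
# **THE PAIRING TEST OF ✓`Prop7LandauTransversalityMargin.hcore_of_pairing` AS A NORM INEQUALITY, AND ITS ASSEMBLY FROM THE DISPLAYED SUPPLIER ROWS** (R2b′ of the (P2-core)
# plan v2, LOCATE memo `pub/ym3-torus/ym-ust-20520-w5/g7/LOCATE-P2-MARGIN-w5g7.md` §2 (M)): `⟪w, D_{U₀}Δ^η l⟫ = κ̄‖Δ^η l‖² + ⟪D*_{U₀}(w − κD_{U₀}l), Δ^η l⟫`, so the test passes as soon as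
# `‖D*_{U₀}(w − κ·D_{U₀} l)‖ < |κ|·‖Δ^η_{U₀} l‖`; with `κ := −η` and `w = M⁻¹Gd N′` this is supplied by (E1) in `L²` (✓`Prop7GaugeDirRotationDivergence.norm_DstarL2_rot_le`-shape:
# `‖D*(w + ηD N′)‖ ≤ η·a′·(‖N′‖ + ‖DN′‖)`), the transfer smallness (`N′ − l` small in `H⁰, H¹, H²` against `‖Δ^η l‖`: R2t + R2q″) and the Poincaré representative (R2a + (H-Z)), under the
# L-only window `2a′(C + θ) + θ < 1`.

Cell `ym3-torus`, width seat `ym-ust-20520-w5` (gen 7).  THEOREMS ONLY (0 `def`, 0 `sorry`).  `--supports stmt-QuantumFields-19200 --as helper`, count-neutral.  YM₃ on T³ is a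
ladder rung (R3), not the Clay problem; nothing here claims the stub, the crux, d = 4 or the mass gap.

WHAT IS PROVED (sorry-free, no definition; ns `…Theorems.Prop7LandauTransversalityPairing`):
* §1 `inner_DL2_covLapSite_eq` — `⟪w, D(Δ l)⟫ = κ̄·⟪Δ l, Δ l⟫ + ⟪D*(w − κ·D l), Δ l⟫` (✓`adjoint_DL2`); ★`pairing_ne_zero_of_norm_lt` — `‖D*(w − κ·D l)‖ < ‖κ‖·‖Δ l‖ ⟹ ⟪w, D(Δ l)⟫ ≠ 0`.
* §2 ★★`htest_of_normSocket` — the pairing test of ✓`hcore_of_pairing` from the NORM SOCKET «for every residual `l` with `Δ^η l ≠ 0` some `(N′, w, κ)` with `M w = Gd N′`, `T w = 0`, `κ ≠ 0`,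
  `‖D*(toL2 w − κ·D(toL2S l))‖ < ‖κ‖·‖Δ^η(toL2S l)‖`».
* §3 ★★★`htest_of_suppliers` — the pairing test from the three DISPLAYED supplier rows: (hP) Poincaré representative «`∃ l₁ ∈ N_S`, same `Δ^η`, `‖l₁‖, ‖Dl₁‖ ≤ C‖Δ^η l‖`» (R2a ✓p656268 +
  (H-Z)); (hS) supplier «`∃ N′ w`, `M w = Gd N′`, `T w = 0`, `‖D*(toL2 w + η·D N′)‖ ≤ η·a′·(‖N′‖ + ‖DN′‖)` ((E1) ✓p656406∕R2e-L² + the `M⁻¹ − 1` factor), `N′ − l₁` `θ`-small in `H⁰, H¹, H²`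
  against `‖Δ^η l₁‖` (R2t + R2q″)»; window `2a′(C + θ) + θ < 1`.  Composes with ✓`hcore_of_pairing` ∕ ✓`hSplitP2_of_pairing` by `exact`.
HONEST SCOPE.  Inner-product bookkeeping; the rows (hP), (hS) are HYPOTHESES (their suppliers are the open files of plan v2: R2a′-tower, R2t, R2t′, R2q″); nothing of print asserted; no stub ∕ crux
statement advanced.

References: T. Bałaban, CMP 99 (1985) 389–434 [Balaban1985BackgroundPropagators] ((3.3) p.391, (3.8) p.392, (3.20)–(3.23) p.394, (3.115) p.418); CMP 102 (1985) 277–309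
[Balaban1985Variational] ((45) p.285, (82)–(83) p.290).
-/

set_option autoImplicit false

noncomputable section

open scoped InnerProductSpace Matrix.Norms.L2Operator ComplexConjugate

namespace Summit.QuantumFields.YangMills.Theorems.Prop7LandauTransversalityPairing

open Literature.MathematicalPhysics.QuantumFieldTheory.Balaban1983to89
open Literature.MathematicalPhysics.QuantumFieldTheory.Balaban1983to89.T3ContinuumYM3Torus
open Literature.MathematicalPhysics.QuantumFieldTheory.Balaban1983to89.T3SectALandauChart (eta eta_pos)
open B11Eq103H1Complex (SiteL2K BondL2K)
open Summit.QuantumFields.YangMills.Theorems.Prop7SectET3Transport (periodsT3)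
open Summit.QuantumFields.YangMills.Theorems.Prop7SymAvgTwSym (QTwS)
open Summit.QuantumFields.YangMills.Theorems.Prop7SectET3HilbertLetters (W₂ toL2 toL2S DL2 DstarL2 covLapSite adjoint_DL2)
open Summit.QuantumFields.YangMills.Theorems.Prop7SectET3GaugeProjector (NS)

variable (F : T3Family) {n K : ℕ} {c₀ : ℝ} [Fact (0 < c₀)]

/-! ## §1 The pairing as `κ̄‖Δl‖² +` an error pairing -/

/-- **`⟪w, D_{U₀}(Δ^η l)⟫ = κ̄·⟪Δ^η l, Δ^η l⟫ + ⟪D*_{U₀}(w − κ·D_{U₀} l), Δ^η l⟫`** (`D* = D†` ✓`adjoint_DL2`, `Δ^η = D*D`). [cite: Balaban1985BackgroundPropagators, (3.8) p.392, (3.23) p.394] -/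
theorem inner_DL2_covLapSite_eq (U₀ : GaugeField (F.P K) 0 (Matrix.specialUnitaryGroup (Fin 2) ℂ)) (w : BondL2K ℂ 3 (periodsT3 F K) c₀ W₂)
    (l : SiteL2K ℂ 3 (periodsT3 F K) c₀ W₂) (κ : ℂ) :
    ⟪w, DL2 F n K c₀ U₀ (covLapSite F n K c₀ U₀ l)⟫_ℂ =
      conj κ * ⟪covLapSite F n K c₀ U₀ l, covLapSite F n K c₀ U₀ l⟫_ℂ + ⟪DstarL2 F n K c₀ U₀ (w - κ • DL2 F n K c₀ U₀ l), covLapSite F n K c₀ U₀ l⟫_ℂ := by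
  have hadj : ∀ (x : BondL2K ℂ 3 (periodsT3 F K) c₀ W₂) (y : SiteL2K ℂ 3 (periodsT3 F K) c₀ W₂),
      ⟪DstarL2 F n K c₀ U₀ x, y⟫_ℂ = ⟪x, DL2 F n K c₀ U₀ y⟫_ℂ := fun x y => by
    rw [← adjoint_DL2, LinearMap.adjoint_inner_left]
  have hΔ : DstarL2 F n K c₀ U₀ (DL2 F n K c₀ U₀ l) = covLapSite F n K c₀ U₀ l := rfl
  calc ⟪w, DL2 F n K c₀ U₀ (covLapSite F n K c₀ U₀ l)⟫_ℂ
      = ⟪κ • DL2 F n K c₀ U₀ l + (w - κ • DL2 F n K c₀ U₀ l), DL2 F n K c₀ U₀ (covLapSite F n K c₀ U₀ l)⟫_ℂ := by rw [add_sub_cancel]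
    _ = conj κ * ⟪DL2 F n K c₀ U₀ l, DL2 F n K c₀ U₀ (covLapSite F n K c₀ U₀ l)⟫_ℂ
          + ⟪w - κ • DL2 F n K c₀ U₀ l, DL2 F n K c₀ U₀ (covLapSite F n K c₀ U₀ l)⟫_ℂ := by rw [inner_add_left, inner_smul_left]
    _ = conj κ * ⟪covLapSite F n K c₀ U₀ l, covLapSite F n K c₀ U₀ l⟫_ℂ + ⟪DstarL2 F n K c₀ U₀ (w - κ • DL2 F n K c₀ U₀ l), covLapSite F n K c₀ U₀ l⟫_ℂ := by
          rw [← hadj, hΔ, ← hadj]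

/-- ★ **THE PAIRING IS NON-ZERO WHEN THE ERROR DIVERGENCE IS SMALLER THAN `|κ|·‖Δ^η l‖`**: `‖D*_{U₀}(w − κ·D_{U₀}l)‖ < ‖κ‖·‖Δ^η_{U₀} l‖ ⟹ ⟪w, D_{U₀}Δ^η_{U₀} l⟫ ≠ 0` (Cauchy–Schwarz on the error
pairing, `re⟪x, x⟫ = ‖x‖²`). [cite: Balaban1985BackgroundPropagators, (3.20)–(3.23) p.394] -/
theorem pairing_ne_zero_of_norm_lt (U₀ : GaugeField (F.P K) 0 (Matrix.specialUnitaryGroup (Fin 2) ℂ)) (w : BondL2K ℂ 3 (periodsT3 F K) c₀ W₂)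
    (l : SiteL2K ℂ 3 (periodsT3 F K) c₀ W₂) {κ : ℂ}
    (hlt : ‖DstarL2 F n K c₀ U₀ (w - κ • DL2 F n K c₀ U₀ l)‖ < ‖κ‖ * ‖covLapSite F n K c₀ U₀ l‖) :
    ⟪w, DL2 F n K c₀ U₀ (covLapSite F n K c₀ U₀ l)⟫_ℂ ≠ 0 := by
  intro h0
  set E := DstarL2 F n K c₀ U₀ (w - κ • DL2 F n K c₀ U₀ l) with hE
  set x := covLapSite F n K c₀ U₀ l with hx
  have hr0 : 0 < ‖x‖ := by
    by_contra hle
    have h00 : ‖x‖ = 0 := le_antisymm (not_lt.1 hle) (norm_nonneg _)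
    rw [h00, mul_zero] at hlt
    exact absurd hlt (not_lt.2 (norm_nonneg _))
  rw [inner_DL2_covLapSite_eq] at h0
  have h1 : conj κ * ⟪x, x⟫_ℂ = -⟪E, x⟫_ℂ := eq_neg_of_add_eq_zero_left h0
  -- `‖κ‖·‖x‖² ≤ ‖κ‖·‖⟪x,x⟫‖ = ‖⟪E,x⟫‖ ≤ ‖E‖·‖x‖`
  have h2 : ‖κ‖ * (‖x‖ * ‖x‖) ≤ ‖E‖ * ‖x‖ := by
    have hre : RCLike.re ⟪x, x⟫_ℂ = ‖x‖ * ‖x‖ := inner_self_eq_norm_mul_norm x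
    have h3 : ‖x‖ * ‖x‖ ≤ ‖⟪x, x⟫_ℂ‖ := by rw [← hre]; exact (le_abs_self _).trans (RCLike.abs_re_le_norm _)
    have h4 : ‖conj κ * ⟪x, x⟫_ℂ‖ = ‖⟪E, x⟫_ℂ‖ := by rw [h1, norm_neg]
    rw [norm_mul, Complex.norm_conj] at h4
    calc ‖κ‖ * (‖x‖ * ‖x‖) ≤ ‖κ‖ * ‖⟪x, x⟫_ℂ‖ := mul_le_mul_of_nonneg_left h3 (norm_nonneg κ)
      _ = ‖⟪E, x⟫_ℂ‖ := h4
      _ ≤ ‖E‖ * ‖x‖ := norm_inner_le_norm _ _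
  have h3 : ‖κ‖ * ‖x‖ ≤ ‖E‖ := le_of_mul_le_mul_right (by nlinarith [h2]) hr0
  exact absurd hlt (not_lt.2 h3)

/-! ## §2 The pairing test from the norm socket -/

/-- ★★ **THE PAIRING TEST OF ✓`hcore_of_pairing` FROM THE NORM SOCKET.**  If for every residual `l` (`toL2S l ∈ N_S(U₀)`) with `Δ^η_{U₀} l ≠ 0` there are `N′`, `w`, `κ ≠ 0` with `M w = Gd N′`
bondwise, `T w = 0` and `‖D*_{U₀}(toL2 w − κ·D_{U₀}(toL2S l))‖ < ‖κ‖·‖Δ^η_{U₀}(toL2S l)‖`, then the pairing test holds. [cite: Balaban1985BackgroundPropagators, (3.20)–(3.23) p.394] -/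
theorem htest_of_normSocket {h : n ≤ K} {cB : ℝ} (U₀ : GaugeField (F.P K) 0 (Matrix.specialUnitaryGroup (Fin 2) ℂ))
    {T : (PBond (F.P K) 0 → Matrix (Fin 2) (Fin 2) ℂ) →L[ℂ] (PBond (F.P n) 0 → Matrix (Fin 2) (Fin 2) ℂ)}
    (M : PBond (F.P K) 0 → (Matrix (Fin 2) (Fin 2) ℂ →L[ℂ] Matrix (Fin 2) (Fin 2) ℂ))
    (Gd : (Site (F.P K) 0 → Matrix (Fin 2) (Fin 2) ℂ) →ₗ[ℂ] (PBond (F.P K) 0 → Matrix (Fin 2) (Fin 2) ℂ))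
    (hsocket : ∀ l : Site (F.P K) 0 → Matrix (Fin 2) (Fin 2) ℂ, toL2S F K c₀ l ∈ NS F n K h c₀ cB U₀ →
      covLapSite F n K c₀ U₀ (toL2S F K c₀ l) ≠ 0 →
      ∃ (N' : Site (F.P K) 0 → Matrix (Fin 2) (Fin 2) ℂ) (w : PBond (F.P K) 0 → Matrix (Fin 2) (Fin 2) ℂ) (κ : ℂ),
        (∀ b, M b (w b) = Gd N' b) ∧ T w = 0 ∧ κ ≠ 0 ∧
        ‖DstarL2 F n K c₀ U₀ (toL2 F K c₀ w - κ • DL2 F n K c₀ U₀ (toL2S F K c₀ l))‖ < ‖κ‖ * ‖covLapSite F n K c₀ U₀ (toL2S F K c₀ l)‖) :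
    ∀ l : Site (F.P K) 0 → Matrix (Fin 2) (Fin 2) ℂ, toL2S F K c₀ l ∈ NS F n K h c₀ cB U₀ →
      covLapSite F n K c₀ U₀ (toL2S F K c₀ l) ≠ 0 →
      ∃ (N' : Site (F.P K) 0 → Matrix (Fin 2) (Fin 2) ℂ) (w : PBond (F.P K) 0 → Matrix (Fin 2) (Fin 2) ℂ),
        (∀ b, M b (w b) = Gd N' b) ∧ T w = 0 ∧ ⟪toL2 F K c₀ w, DL2 F n K c₀ U₀ (covLapSite F n K c₀ U₀ (toL2S F K c₀ l))⟫_ℂ ≠ 0 := by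
  intro l hl hΔ
  obtain ⟨N', w, κ, hMw, hTw, -, hlt⟩ := hsocket l hl hΔ
  exact ⟨N', w, hMw, hTw, pairing_ne_zero_of_norm_lt F U₀ _ _ hlt⟩

/-! ## §3 The pairing test from the displayed supplier rows -/

/-- ★★★ **THE PAIRING TEST FROM THE SUPPLIER ROWS OF PLAN v2.**  At the member (`η = L^{−(K−n)} > 0`), for the data `T, M, Gd` of ✓`hcore_of_pairing`: IF
(hP) every residual `l` has a POINCARÉ REPRESENTATIVE `l₁ ∈ N_S(U₀)` with the same `Δ^η_{U₀}`-image and `‖toL2S l₁‖, ‖D_{U₀}(toL2S l₁)‖ ≤ C·‖Δ^η_{U₀}(toL2S l)‖` (R2a + (H-Z)), and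
(hS) every residual `l₁` has a TRANSFER `(N′, w)` with `M w = Gd N′`, `T w = 0`, the rotated-direction divergence bound `‖D*_{U₀}(toL2 w + η·D_{U₀}(toL2S N′))‖ ≤ η·a′·(‖toL2S N′‖ +
‖D_{U₀}(toL2S N′)‖)` ((E1) in `L²` + the `M⁻¹ − 1` factor) and `N′ − l₁` `θ`-small in `H⁰, H¹, H²` against `‖Δ^η_{U₀}(toL2S l₁)‖` (R2t + R2q″), under the window `2a′(C + θ) + θ < 1` (`0 ≤ a′`),
THEN the pairing test of ✓`hcore_of_pairing` holds (with `κ := −η`).  [cite: Balaban1985BackgroundPropagators, (3.3) p.391, (3.8) p.392, (3.20)–(3.23) p.394; Balaban1985Variational, (45) p.285] -/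
theorem htest_of_suppliers {h : n ≤ K} {cB : ℝ} (U₀ : GaugeField (F.P K) 0 (Matrix.specialUnitaryGroup (Fin 2) ℂ))
    {T : (PBond (F.P K) 0 → Matrix (Fin 2) (Fin 2) ℂ) →L[ℂ] (PBond (F.P n) 0 → Matrix (Fin 2) (Fin 2) ℂ)}
    (M : PBond (F.P K) 0 → (Matrix (Fin 2) (Fin 2) ℂ →L[ℂ] Matrix (Fin 2) (Fin 2) ℂ))
    (Gd : (Site (F.P K) 0 → Matrix (Fin 2) (Fin 2) ℂ) →ₗ[ℂ] (PBond (F.P K) 0 → Matrix (Fin 2) (Fin 2) ℂ))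
    {C a' θ : ℝ} (ha' : 0 ≤ a') (hwin : 2 * a' * (C + θ) + θ < 1)
    (hP : ∀ l : Site (F.P K) 0 → Matrix (Fin 2) (Fin 2) ℂ, toL2S F K c₀ l ∈ NS F n K h c₀ cB U₀ →
      ∃ l₁ : Site (F.P K) 0 → Matrix (Fin 2) (Fin 2) ℂ, toL2S F K c₀ l₁ ∈ NS F n K h c₀ cB U₀ ∧
        covLapSite F n K c₀ U₀ (toL2S F K c₀ l₁) = covLapSite F n K c₀ U₀ (toL2S F K c₀ l) ∧
        ‖toL2S F K c₀ l₁‖ ≤ C * ‖covLapSite F n K c₀ U₀ (toL2S F K c₀ l)‖ ∧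
        ‖DL2 F n K c₀ U₀ (toL2S F K c₀ l₁)‖ ≤ C * ‖covLapSite F n K c₀ U₀ (toL2S F K c₀ l)‖)
    (hS : ∀ l₁ : Site (F.P K) 0 → Matrix (Fin 2) (Fin 2) ℂ, toL2S F K c₀ l₁ ∈ NS F n K h c₀ cB U₀ →
      ∃ (N' : Site (F.P K) 0 → Matrix (Fin 2) (Fin 2) ℂ) (w : PBond (F.P K) 0 → Matrix (Fin 2) (Fin 2) ℂ),
        (∀ b, M b (w b) = Gd N' b) ∧ T w = 0 ∧
        ‖DstarL2 F n K c₀ U₀ (toL2 F K c₀ w + ((eta F n K : ℝ) : ℂ) • DL2 F n K c₀ U₀ (toL2S F K c₀ N'))‖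
          ≤ eta F n K * a' * (‖toL2S F K c₀ N'‖ + ‖DL2 F n K c₀ U₀ (toL2S F K c₀ N')‖) ∧
        ‖covLapSite F n K c₀ U₀ (toL2S F K c₀ N' - toL2S F K c₀ l₁)‖ ≤ θ * ‖covLapSite F n K c₀ U₀ (toL2S F K c₀ l₁)‖ ∧
        ‖toL2S F K c₀ N' - toL2S F K c₀ l₁‖ ≤ θ * ‖covLapSite F n K c₀ U₀ (toL2S F K c₀ l₁)‖ ∧
        ‖DL2 F n K c₀ U₀ (toL2S F K c₀ N' - toL2S F K c₀ l₁)‖ ≤ θ * ‖covLapSite F n K c₀ U₀ (toL2S F K c₀ l₁)‖) :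
    ∀ l : Site (F.P K) 0 → Matrix (Fin 2) (Fin 2) ℂ, toL2S F K c₀ l ∈ NS F n K h c₀ cB U₀ →
      covLapSite F n K c₀ U₀ (toL2S F K c₀ l) ≠ 0 →
      ∃ (N' : Site (F.P K) 0 → Matrix (Fin 2) (Fin 2) ℂ) (w : PBond (F.P K) 0 → Matrix (Fin 2) (Fin 2) ℂ),
        (∀ b, M b (w b) = Gd N' b) ∧ T w = 0 ∧ ⟪toL2 F K c₀ w, DL2 F n K c₀ U₀ (covLapSite F n K c₀ U₀ (toL2S F K c₀ l))⟫_ℂ ≠ 0 := by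
  have hη : 0 < eta F n K := eta_pos F n K
  intro l hl hΔ
  obtain ⟨l₁, hl₁, hΔeq, hl₁0, hl₁1⟩ := hP l hl
  obtain ⟨N', w, hMw, hTw, hrot, hH2, hH0, hH1⟩ := hS l₁ hl₁
  refine ⟨N', w, hMw, hTw, ?_⟩
  rw [← hΔeq]
  refine pairing_ne_zero_of_norm_lt F U₀ _ _ (κ := -(((eta F n K : ℝ) : ℂ))) ?_
  -- sizes, all against `r := ‖Δ^η l₁‖ = ‖Δ^η l‖ > 0`
  set r : ℝ := ‖covLapSite F n K c₀ U₀ (toL2S F K c₀ l₁)‖ with hr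
  have hr0 : 0 < r := by rw [hr, hΔeq]; exact norm_pos_iff.2 hΔ
  rw [← hΔeq, ← hr] at hl₁0 hl₁1
  have hκ : ‖-(((eta F n K : ℝ) : ℂ))‖ = eta F n K := by rw [norm_neg, Complex.norm_real, Real.norm_of_nonneg hη.le]
  rw [hκ]
  -- `toL2 w − (−η)•D l₁ = [toL2 w + η D N′] − η•D(N′ − l₁)`
  have hsplit : toL2 F K c₀ w - (-(((eta F n K : ℝ) : ℂ))) • DL2 F n K c₀ U₀ (toL2S F K c₀ l₁)
      = (toL2 F K c₀ w + ((eta F n K : ℝ) : ℂ) • DL2 F n K c₀ U₀ (toL2S F K c₀ N')) - ((eta F n K : ℝ) : ℂ) • DL2 F n K c₀ U₀ (toL2S F K c₀ N' - toL2S F K c₀ l₁) := by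
    rw [map_sub, smul_sub, neg_smul, sub_neg_eq_add]; abel
  have hΔN : DstarL2 F n K c₀ U₀ (DL2 F n K c₀ U₀ (toL2S F K c₀ N' - toL2S F K c₀ l₁)) = covLapSite F n K c₀ U₀ (toL2S F K c₀ N' - toL2S F K c₀ l₁) := rfl
  have hN0 : ‖toL2S F K c₀ N'‖ ≤ (C + θ) * r := by
    calc ‖toL2S F K c₀ N'‖ = ‖toL2S F K c₀ l₁ + (toL2S F K c₀ N' - toL2S F K c₀ l₁)‖ := by rw [add_sub_cancel]
      _ ≤ ‖toL2S F K c₀ l₁‖ + ‖toL2S F K c₀ N' - toL2S F K c₀ l₁‖ := norm_add_le _ _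
      _ ≤ C * r + θ * r := add_le_add hl₁0 hH0
      _ = (C + θ) * r := by ring
  have hN1 : ‖DL2 F n K c₀ U₀ (toL2S F K c₀ N')‖ ≤ (C + θ) * r := by
    calc ‖DL2 F n K c₀ U₀ (toL2S F K c₀ N')‖ = ‖DL2 F n K c₀ U₀ (toL2S F K c₀ l₁) + DL2 F n K c₀ U₀ (toL2S F K c₀ N' - toL2S F K c₀ l₁)‖ := by
          rw [← map_add, add_sub_cancel]
      _ ≤ ‖DL2 F n K c₀ U₀ (toL2S F K c₀ l₁)‖ + ‖DL2 F n K c₀ U₀ (toL2S F K c₀ N' - toL2S F K c₀ l₁)‖ := norm_add_le _ _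
      _ ≤ C * r + θ * r := add_le_add hl₁1 hH1
      _ = (C + θ) * r := by ring
  calc ‖DstarL2 F n K c₀ U₀ (toL2 F K c₀ w - (-(((eta F n K : ℝ) : ℂ))) • DL2 F n K c₀ U₀ (toL2S F K c₀ l₁))‖
      = ‖DstarL2 F n K c₀ U₀ (toL2 F K c₀ w + ((eta F n K : ℝ) : ℂ) • DL2 F n K c₀ U₀ (toL2S F K c₀ N'))
          - ((eta F n K : ℝ) : ℂ) • covLapSite F n K c₀ U₀ (toL2S F K c₀ N' - toL2S F K c₀ l₁)‖ := by rw [hsplit, map_sub, map_smul, hΔN]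
    _ ≤ ‖DstarL2 F n K c₀ U₀ (toL2 F K c₀ w + ((eta F n K : ℝ) : ℂ) • DL2 F n K c₀ U₀ (toL2S F K c₀ N'))‖
          + ‖((eta F n K : ℝ) : ℂ) • covLapSite F n K c₀ U₀ (toL2S F K c₀ N' - toL2S F K c₀ l₁)‖ := norm_sub_le _ _
    _ ≤ eta F n K * a' * (‖toL2S F K c₀ N'‖ + ‖DL2 F n K c₀ U₀ (toL2S F K c₀ N')‖) + eta F n K * (θ * r) := by
          refine add_le_add hrot ?_
          rw [norm_smul, Complex.norm_real, Real.norm_of_nonneg hη.le]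
          exact mul_le_mul_of_nonneg_left hH2 hη.le
    _ ≤ eta F n K * a' * ((C + θ) * r + (C + θ) * r) + eta F n K * (θ * r) := by gcongr
    _ = eta F n K * ((2 * a' * (C + θ) + θ) * r) := by ring
    _ < eta F n K * (1 * r) := by
          refine mul_lt_mul_of_pos_left ?_ hη
          exact mul_lt_mul_of_pos_right hwin hr0
    _ = eta F n K * ‖covLapSite F n K c₀ U₀ (toL2S F K c₀ l₁)‖ := by rw [one_mul, hr]

end Summit.QuantumFields.YangMills.Theorems.Prop7LandauTransversalityPairing

end
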